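import Summits.AtomisticToContinuum.Crystallization.Theorems.ChartedZeroExcessLayeredLatticeLiouvilleH

/-!
# ChartedZeroExcessLayered · LatticeLiouville — part I/10: §F «HalvingBasin», statements and the first cut (decomp-a2c lens-2 generation 26; NEW content, imports part H; second-cut glue and columns in part J):
the lens «structural dichotomy (special vs generic)» applied to g25's DECLARED RESIDUAL OF RECORD H = `FlatnessHalving 2 (1/16) (1/64)`
(critic row 455 (a)).  H bundles THREE mechanisms of different type, and the column needs each only in a WEAKER form:

* **A∞ «ScaleExtinction Λ θ κ»** — BLOW-DOWN FLATNESS (qualitative, per configuration): given both linear certificates, a θ-good door set all of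
  whose root windows are κ-flat is EVENTUALLY layer-flat, `EventuallyLayerFlat Λ S := ∀ ε > 0, ∃ R₁, ∀ R ≥ R₁, NearHomL2BD Λ ε 4 S (window R)` —
  the misfit tends to 0 along the scales, floor `R₁(S, ε)` NOT uniform in ε.  This is the nonlinear Liouville statement AT FINITE AMPLITUDE (strain
  oscillation inside the clean window, never small): no perturbative tool reaches it; it is INSENSITIVE to localised cores (a core of fixed misfit
  mass contributes `O(R⁻³)` to the window mean square).  [UNDECIDED · TRUE-type · IDEA-NEEDED (blow-down rigidity at finite amplitude) · INSTRUMENTABLE: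
  the sign of `d log κ_needed / d log R` on RELAXED (unclamped) clusters — census TAG 158/162 measured `+0.9` on CLAMPED hcp balls, which carry an
  imposed far-field strain gradient (R162.md e125897a…); A∞ predicts `< 0` on door-like data.]
* **U «FlatnessUpgrade Λ θ κ»** — NO CORES (qualitative, per configuration): an eventually layer-flat θ-good κ-flat door set is ASYMPTOTICALLY
  (= eventually EXACTLY) layer-flat, `AsymptoticallyLayerFlat Λ S` (part G: floor uniform in ε).  A localised finite-amplitude equilibrium distortion of a
  perfect-topology crystal («core», misfit mass `m > 0`, elastic far field `∇u ~ r⁻³`) is eventually flat (`κ(R) ~ m/R³ → 0`) but never exactly flat on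
  a window containing it: U says precisely that door sets have no cores.  [UNDECIDED · TRUE-type · IDEA-NEEDED (finite-amplitude unique-continuation /
  no-core rigidity) · INSTRUMENTABLE: CORE-HUNT — relax a perfect fcc/hcp ball from strong LOCALISED defect-free perturbations; any metastable
  non-layered end state with clean two-shell environments is a candidate core.]
  ★ THE SEAM `E ⟺ A∞ ∧ U` is by hypothesis-splitting at the threshold «eventually flat» (`flatnessExtinctionP_iff_scale_upgrade`, both directions
  PROVED, trivial): E(Λ,θ,κ) of part G = A∞ ∧ U EXACTLY, so BOTH new pieces are WEAKER than E, hence than P♭-in-substance and than H.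
* **H♭ «HalvingBasin Λ θ»** — the QUANTITATIVE ε-regularity with an HONEST basin: H with its level ceiling EXISTENTIAL and chosen after δ
  (`∃ κ₀ > 0` in place of the literal `1/64`; CubicStability-type objection to hand-picked thresholds removed).  ★ `U ⟸ H♭` PROVED for EVERY κ
  (`flatnessUpgradeP_of_halvingBasin`: eventual κ₀-flatness supplies the big windows, the dyadic iteration of part G runs from the floor `max R₀ R₁`);
  `H♭ ⟸ H(κ)` for every `κ > 0` (one line).  [UNDECIDED · TRUE-type · ATTACKABLE-XL — but see the next two items: H♭ is NOT purely perturbative.]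
* **THE CONCENTRATION CAVEAT (new, corrects the g25 why-easier «ONE compactness + linearisation argument»)**: a sequence of windows violating the
  halving with `η_k → 0`, `R_k → ∞` blows up to a limit field PLUS A DEFECT MEASURE; a core (normalised misfit mass concentrating at a point, limit field
  `v ≡ 0`) violates the halving at EVERY large radius while the Campanato estimate on the limit says nothing.  Compactness-and-linearisation proves
  the halving ONLY on windows that are flat IN SUP as well (uniformly small strain ⇒ uniformly perturbative ⇒ discrete Caccioppoli / interior
  estimates for the linearised layered operator ⇒ no concentration).  Hence the second lens cut, beneath H♭:
  - **H_pert «PerturbativeDecay Λ θ»** — SPECIAL (sup-flat) windows: for every target contraction `c > 0` there are `τ₀, κ₀, M, R₀` such that a big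
    window that is η-flat in mean square AND τ₀-flat in sup under ONE chart (`NearHomL2SupBD Λ η τ₀ 4`) has a `c·η`-flat small window.
    [UNDECIDED · TRUE-type · ATTACKABLE·L–XL — the honest perturbative statement: linearisation at the chart is uniformly valid; blow-up limits converge
    STRONGLY; linear Liouville (the certificates) + Campanato `C/M²` for the quotient seminorm; discrete floor handled by `R₀`.]  `H_pert ⟸ H(κ)` PROVED
    (`perturbativeDecayP_of_flatnessHalvingP`: iterate H along `M^j`).
  - **K «CoreExclusion Λ θ»** — GENERIC (cored) windows are EMPTY: mean-square η-flatness of the window of radius `M·R` forces, for `η ≤ κ₁(τ₀)`, a chart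
    of the window of radius `R` that is `C·η`-flat in mean square AND `τ₀`-flat in sup (`C, M` depending on δ only) — the interior `L² → L^∞` estimate
    for the NONLINEAR problem = no cores.  [UNDECIDED · TRUE-type · IDEA-NEEDED (the finite-amplitude content of H, isolated) · INSTRUMENTABLE: CORE-HUNT.]
  ★ GLUE `H♭ ⟸ H_pert ∧ K` PROVED (`halvingBasinP_of_perturbative_core`: ratio `M_K·M_P`, contraction `c = 1/(2C)`, basin `min κ₁ (κ₀/C)`).
* EXHAUSTION at both cuts is classical: every door set is eventually flat or not (A∞ empties the second class, U upgrades the first); every flat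
  big window is sup-flat after K or K fails.

COLUMNS: part J (`gap_and_pert_1_50_of_certs_16B` SIX leaves D-free, `_16E`, `_16U`, `_16K`, `_16b`, `_16BW`, `_16KW`, the eleven-leaf audit column).
CENSUS RECORD (critic row 457 (B), TAG 162 CLOSED, R162.md e125897ae1155336): R(2,1/16,1/16)'s literal κ₁ = 1/16 is SUPPORTED at the tested scales
(13 clean states, R = 2…6a, max κ_needed 0.0189, margin ×3.3; C_rig ≤ 1.56); FAILURE MODE OF RECORD for R = «uniformity in R» (clamped hcp states:
d log κ/d log R ≈ 0.9 from the imposed strain gradient, extrapolating to 1/16 near R ≈ 20a; untestable beyond R = 6a on those data) — no statement change.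
TAG 163 (K163.md 1d1ceba71a6418c8, kit j343934; K163B.md 7d12c90549ae688d, kit j343966; critic row 460): D(2,1/16,1/16,1/64) CENSUS-SUPPORTED (relaxed/imposed
misfit ratio < 1 in every run and window, ≤ 0.5 once R ≥ λ/2); H-LEVEL/M (this node's instrument for H♭ / H_pert): (a) LEVEL-INDEPENDENCE of the response
CONFIRMED (κ₀ ∈ {1/64, 1/256, 1/1024} give the same window ratios: linear regime); (b) ONE-STEP RATIOS c(R, M) = κ_rel(B_R)/κ_rel(B_{MR}) ≤ 0.48 at EVERY
(R, M, level) measured, decaying like M^(−2.4…−2.8) (Campanato predicts C/M²; M = 2 suffices, c ≤ 0.2 for R ≥ 3a, M = 3 gives c ≤ 0.08); (c) at η = 1/16 a mild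
level dependence (×1.8 vs 1/64 at R = 4a) but still strongly contracting ⇒ the rigidity-level columns `_16H` / `_16B` are float-supported.  THE EFFECTIVE-
WAVELENGTH / R₀ SENTENCE (owed per row 460): the recorded failure mode «contraction factor → 1 for windows ≪ data wavelength» belongs to the RELAXED-vs-IMPOSED
comparison (D's instrument): long-wave imposed data is already nearly lattice-harmonic inside a ball B_R with R ≪ λ, so relaxation has nothing to remove there.
H♭ / H_pert / K compare TWO WINDOWS OF ONE EQUILIBRIUM configuration; for a (nearly) harmonic displacement the window-to-window misfit ratio is SCALE-FREE
(Campanato: c ≈ C/M² whatever the spectral content — K163B's c(R, M) at R = 2a…4a < λ/2 included), so their floor `R₀` is a LATTICE floor (discreteness of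
the window counts at environment radius 4), not a wavelength floor, and in the column the small windows inherit flatness from the large ones by ITERATION
(U ⟸ H♭), never from D.  TAG 164 (B164.md a503cf4249c7d6b0): C_lay `LayeredCrystalStability` Bloch-side SUPPORTED (no phonon instability on any clean
sample of the polytypes 2H/3C/4H/6H/9R; interlayer sliding stiffness ≥ 0.18 in the clean window).  Caveat for all: clamped finite balls, not door sets.
WHY NOVEL (tree-relative; presearch 2026-08-31 in the g26 NODE card): `lean search 'ScaleExtinction|HalvingBasin|CoreExclusion|PerturbativeDecay|
EventuallyLayerFlat|NearHomL2SupBD'` → no hits; the tree's and v9's ε-regularity objects are single-level (`FlatnessHalving`, literal basin) or global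
(`twoPeriodic_of_forall_nearHomBD`); no windowed mean-square-AND-sup currency, no no-core statement, no qualitative blow-down piece exists.  In print the
three mechanisms are the three chapters of continuum ε-regularity (excess decay by compactness: Allard / Schoen–Uhlenbeck; no-concentration via
monotonicity or minimality; blow-down / Bernstein-type Liouville) — for discrete nonlinear-elastic point configurations none is in the corpus (queries on
the card).  WHY EACH PIECE IS STRICTLY WEAKER: A∞, U ⟸ E ⟸ H (proved here / part G) and E ≡ P♭ ⇍ A∞, U separately (MUST-FAIL probes g26/bc);
H♭ ⟸ H (proved), H ⇍ H♭ (basin literal vs existential, MUST-FAIL); H_pert ⟸ H (proved), converse MUST-FAIL (sup hypothesis); K: incomparable with H,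
weaker than N (exactly layered door sets are 0-flat in sup at every window; TRUE-type).
-/

noncomputable section

open scoped BigOperators InnerProductSpace RealInnerProductSpace
open MeasureTheory Set Metric Filter Topology
open Summit.AtomisticToContinuum.Crystallization.Theorems.ChartedPlanarOrderRigidityDoor (E3 IsClean IsNash IsCharted VisibleGap PertRegime atomsIn)
open Summit.AtomisticToContinuum.Crystallization.Theorems.ChartedPlanarOrderDensityDichotomy (μS IsSep nK nK_nonneg)
open Summit.AtomisticToContinuum.Crystallization.Theorems.ChartedPlanarOrderMesoCut (IsDoorSet NearHom LayeredHom EnvClose)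
open Summit.AtomisticToContinuum.Crystallization.Theorems.OverbindingBudgetLiouvilleDictionary (NearHomBD)
open Summit.AtomisticToContinuum.Crystallization.Theorems.ChartedPlanarOrderDoorLayered
  (TwoPeriodic DoorPeriodic PeriodicBulkGapDoor gap_and_pert_1_50_of_periodic NearHomL2BD nearHomL2BD_mono nearHomBD_of_nearHomL2BD
   sq_le_finsum_mem not_nearHomL2BD_singleton envClose_mono)
open Summit.AtomisticToContinuum.Crystallization.Theorems.ChartedPlanarOrderDoorLayeredOsc (IsTwoShellAffineGood DoorPeriodicOsc)
open Summit.AtomisticToContinuum.Crystallization.Theorems.ChartedPlanarOrderCleanScaleP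
  (IsCleanP IsDoorSetP DoorPeriodicP isDoorSetP_mono doorPeriodic_of_doorPeriodicP isDoorSetP_one_iff doorPeriodicP_one_iff)

namespace Summit.AtomisticToContinuum.Crystallization.Theorems.ChartedZeroExcessLayeredLatticeLiouville

/-! ## §F.1  The currencies: eventual flatness, and mean-square-AND-sup flatness under one chart -/

/-- **«EventuallyLayerFlat Λ S»** — the misfit of the root windows TENDS TO ZERO along the scales: for every `ε > 0`, beyond some radius `R₁(ε)` every
root window is `ε`-flat in mean square (environment radius 4, charts of distortion `≤ Λ` re-chosen per window).  WEAKER than part G's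
`AsymptoticallyLayerFlat Λ S` (there `R₀` is uniform in ε, i.e. the windows are eventually EXACTLY flat): `AsymptoticallyLayerFlat.eventually`.
Non-vacuous: `not_eventuallyLayerFlat_singleton`. [this file, g26] -/
def EventuallyLayerFlat (Λ : ℝ) (S : Set E3) : Prop :=
  ∀ ε : ℝ, 0 < ε → ∃ R₁ : ℝ, ∀ R : ℝ, R₁ ≤ R → NearHomL2BD Λ ε 4 S (atomsIn (μS S) 0 R)

/-- asymptotically (exactly) flat ⇒ eventually flat (swap the quantifiers). -/
theorem AsymptoticallyLayerFlat.eventually {Λ : ℝ} {S : Set E3} (h : AsymptoticallyLayerFlat Λ S) : EventuallyLayerFlat Λ S := by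
  obtain ⟨R₀, h⟩ := h
  exact fun ε hε => ⟨R₀, fun R hR => h ε hε R hR⟩

/-- **non-vacuity**: an isolated atom is NOT eventually layer-flat at `Λ = 2` (its root windows are `{0}`; tree `not_nearHomL2BD_singleton`,
`Λ² ε = 4·(1/8) < 1`). -/
theorem not_eventuallyLayerFlat_singleton : ¬ EventuallyLayerFlat 2 ({0} : Set E3) := by
  intro h
  obtain ⟨R₁, h1⟩ := h (1 / 8) (by norm_num)
  have hw : atomsIn (μS ({0} : Set E3)) 0 (max R₁ 0) = {0} := by
    ext p
    rw [mem_atomsIn_iff, mem_singleton_iff]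
    constructor
    · exact fun hp => hp.1
    · rintro rfl; exact ⟨rfl, by rw [norm_zero]; exact le_max_right _ _⟩
  have h2 := h1 (max R₁ 0) (le_max_left _ _)
  rw [hw] at h2
  exact not_nearHomL2BD_singleton (by norm_num) (by norm_num) (by norm_num) (0 : E3) h2

/-- **«NearHomL2SupBD Λ κ τ₀ r S Q»** — `Q` is near ONE layered structure under ONE chart of distortion `≤ Λ` BOTH in mean square (`∑ τ² ≤ κ·#Q`) AND
in sup (`τ x ≤ τ₀` at every `x ∈ Q`): the tree currency `NearHomL2BD` (…DoorLayered) with the pointwise ceiling added to the SAME deviation profile.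
Sup-flatness `τ₀` small = the strain is uniformly small on `Q` = the window is uniformly inside the perturbative regime (no cores).  It implies both tree
currencies (`nearHomL2BD_of_L2Sup`, `nearHomBD_of_L2Sup`); on a FINITE window the mean square alone gives the crude ceiling `√(κ·#Q)`
(`nearHomL2SupBD_of_L2BD`), so the content of a `τ₀` INDEPENDENT of the window size is exactly what K «CoreExclusion» asserts. [this file, g26] -/
def NearHomL2SupBD (Λ κ τ₀ r : ℝ) (S Q : Set E3) : Prop :=
  ∃ (L : E3 ≃L[ℝ] E3), ‖(L : E3 →L[ℝ] E3)‖ ≤ Λ ∧ ‖(L.symm : E3 →L[ℝ] E3)‖ ≤ Λ ∧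
    ∃ (w : ℤ → E3) (Ψ : E3 → E3) (τ : E3 → ℝ), Set.InjOn Ψ Q ∧ Set.MapsTo Ψ Q (LayeredHom (L : E3 →L[ℝ] E3) w) ∧
      (∀ x ∈ Q, 0 ≤ τ x ∧ τ x ≤ τ₀ ∧ EnvClose (τ x) r S x (LayeredHom (L : E3 →L[ℝ] E3) w) (Ψ x)) ∧
      ∑ᶠ x ∈ Q, τ x ^ 2 ≤ κ * nK Q

/-- drop the sup clause: `NearHomL2SupBD ⇒ NearHomL2BD` (same chart, same profile). -/
theorem nearHomL2BD_of_L2Sup {Λ κ τ₀ r : ℝ} {S Q : Set E3} (h : NearHomL2SupBD Λ κ τ₀ r S Q) : NearHomL2BD Λ κ r S Q := by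
  obtain ⟨L, hL, hL', w, Ψ, τ, hinj, hmaps, hτ, hsum⟩ := h
  exact ⟨L, hL, hL', w, Ψ, τ, hinj, hmaps, fun x hx => ⟨(hτ x hx).1, (hτ x hx).2.2⟩, hsum⟩

/-- drop the mean-square clause: `NearHomL2SupBD ⇒ NearHomBD` at the sup tolerance `τ₀` (tree `envClose_mono`). -/
theorem nearHomBD_of_L2Sup {Λ κ τ₀ r : ℝ} {S Q : Set E3} (h : NearHomL2SupBD Λ κ τ₀ r S Q) : NearHomBD Λ τ₀ r S Q := by
  obtain ⟨L, hL, hL', w, Ψ, τ, hinj, hmaps, hτ, _⟩ := h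
  exact ⟨L, hL, hL', w, Ψ, hinj, hmaps, fun x hx => envClose_mono (hτ x hx).2.1 (hτ x hx).2.2⟩

/-- on a FINITE window the mean square alone bounds the sup by `√(κ·#Q)` (one term of a sum of squares; cf. tree `nearHomBD_of_nearHomL2BD`). -/
theorem nearHomL2SupBD_of_L2BD {Λ κ r : ℝ} {S Q : Set E3} (hQ : Q.Finite) (h : NearHomL2BD Λ κ r S Q) :
    NearHomL2SupBD Λ κ (Real.sqrt (κ * nK Q)) r S Q := by
  obtain ⟨L, hL, hL', w, Ψ, τ, hinj, hmaps, hτ, hsum⟩ := h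
  refine ⟨L, hL, hL', w, Ψ, τ, hinj, hmaps, fun x hx => ⟨(hτ x hx).1, ?_, (hτ x hx).2⟩, hsum⟩
  have h1 : τ x ^ 2 ≤ κ * nK Q := (sq_le_finsum_mem hQ τ hx).trans hsum
  calc τ x = Real.sqrt (τ x ^ 2) := (Real.sqrt_sq (hτ x hx).1).symm
    _ ≤ Real.sqrt (κ * nK Q) := Real.sqrt_le_sqrt h1

/-- `NearHomL2SupBD` is monotone in the mean-square level and in the sup ceiling. -/
theorem NearHomL2SupBD.mono {Λ κ κ' τ₀ τ₀' r : ℝ} (hκ : κ ≤ κ') (hτ₀ : τ₀ ≤ τ₀') {S Q : Set E3} (h : NearHomL2SupBD Λ κ τ₀ r S Q) :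
    NearHomL2SupBD Λ κ' τ₀' r S Q := by
  obtain ⟨L, hL, hL', w, Ψ, τ, hinj, hmaps, hτ, hsum⟩ := h
  exact ⟨L, hL, hL', w, Ψ, τ, hinj, hmaps, fun x hx => ⟨(hτ x hx).1, (hτ x hx).2.1.trans hτ₀, (hτ x hx).2.2⟩,
    hsum.trans (mul_le_mul_of_nonneg_right hκ (nK_nonneg Q))⟩

/-! ## §F.2  The pieces (pattern-scale ceiling `aHi` first — `IsDoorSetP aHi`, part H / lens-3's …CleanScaleP — then `aHi = 1` by `Iff.rfl`) -/

/-- E at pattern-scale ceiling `aHi` (part G's `FlatnessExtinction` over `IsDoorSetP aHi` door sets; `_one_iff`). [this file, g26] -/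
def FlatnessExtinctionP (aHi Λ θ κ : ℝ) : Prop :=
  LatticeLiouvilleCert → LayeredLiouvilleCert → ∀ δ : ℝ, 0 < δ → ∀ S : Set E3, IsDoorSetP aHi δ S → (∀ q ∈ S, IsTwoShellAffineGood θ S q) →
    (∀ R : ℝ, 0 < R → NearHomL2BD Λ κ 4 S (atomsIn (μS S) 0 R)) → AsymptoticallyLayerFlat Λ S

/-- **A∞(aHi; Λ, θ, κ) «ScaleExtinction»** — BLOW-DOWN FLATNESS: given both linear certificates, every θ-good `aHi`-door set all of whose root windows
are κ-flat is EVENTUALLY layer-flat (misfit `→ 0` along the scales; floor per configuration and per ε).  = E with its conclusion weakened from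
`AsymptoticallyLayerFlat` to `EventuallyLayerFlat`.  UNDECIDED · TRUE-type (exactly layered door sets are 0-flat at every radius) · IDEA-NEEDED: the
nonlinear Liouville theorem at FINITE strain amplitude (blow-down rigidity; no linearisation is available — the strain oscillation of a κ-flat window is
`O(√κ)`, inside the clean window but not small); INSENSITIVE to localised cores.  Why it might fail: a non-layered entire Nash clean charted configuration
with strain oscillation that does not decay along the scales (a finite-amplitude «elastic soliton»; none known for pair potentials, none excluded).
INSTRUMENT: sign of `d log κ_needed/d log R` on relaxed unclamped clusters (TAG 158/162: `+0.9` on CLAMPED hcp balls with imposed gradient, R162.md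
e125897a…).  ANTI-monotone in θ and κ, ANTITONE in the ceiling. [this file, g26] -/
def ScaleExtinctionP (aHi Λ θ κ : ℝ) : Prop :=
  LatticeLiouvilleCert → LayeredLiouvilleCert → ∀ δ : ℝ, 0 < δ → ∀ S : Set E3, IsDoorSetP aHi δ S → (∀ q ∈ S, IsTwoShellAffineGood θ S q) →
    (∀ R : ℝ, 0 < R → NearHomL2BD Λ κ 4 S (atomsIn (μS S) 0 R)) → EventuallyLayerFlat Λ S

/-- **U(aHi; Λ, θ, κ) «FlatnessUpgrade»** — NO CORES: given both certificates, a θ-good κ-flat `aHi`-door set that is EVENTUALLY layer-flat is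
ASYMPTOTICALLY layer-flat (beyond a uniform radius every root window is flat at EVERY level, i.e. exactly layered there — part G's special class).
= E with the extra hypothesis `EventuallyLayerFlat Λ S`; `E ⟺ A∞ ∧ U` (`flatnessExtinctionP_iff_scale_upgrade`).  UNDECIDED · TRUE-type · IDEA-NEEDED:
a «core» (localised finite-amplitude equilibrium distortion of a perfect-topology crystal, misfit mass `m`, far field `∇u ~ r⁻³`) is eventually flat
(`κ(R) ~ m R⁻³`) yet no window containing it is exactly flat — U is the statement that door sets carry no cores (finite-amplitude unique continuation
from infinity for the Nash equations).  PROVED from the quantitative H♭ (`flatnessUpgradeP_of_halvingBasin`).  INSTRUMENT: CORE-HUNT (relax perfect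
fcc/hcp balls from strong localised defect-free perturbations; a metastable clean non-layered end state is a candidate core). [this file, g26] -/
def FlatnessUpgradeP (aHi Λ θ κ : ℝ) : Prop :=
  LatticeLiouvilleCert → LayeredLiouvilleCert → ∀ δ : ℝ, 0 < δ → ∀ S : Set E3, IsDoorSetP aHi δ S → (∀ q ∈ S, IsTwoShellAffineGood θ S q) →
    (∀ R : ℝ, 0 < R → NearHomL2BD Λ κ 4 S (atomsIn (μS S) 0 R)) → EventuallyLayerFlat Λ S → AsymptoticallyLayerFlat Λ S

/-- **H♭(aHi; Λ, θ) «HalvingBasin»** — the ONE-STEP ε-regularity with an HONEST BASIN: given both certificates, for every δ there are a level ceiling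
`κ₀ > 0` (EXISTENTIAL, chosen after δ — v9's H fixed the literal `κ₀ = 1/64` before δ), a scale ratio `M ≥ 1` and a floor `R₀ > 0` such that on every
θ-good `aHi`-door set, at every level `0 < η ≤ κ₀` and radius `R ≥ R₀`: `η`-flat on the window of radius `M·R` ⇒ `η/2`-flat on the window of radius `R`.
WEAKER than `FlatnessHalvingP aHi Λ θ κ` for every `κ > 0` (`halvingBasinP_of_flatnessHalvingP`); gives U at every κ; ⟸ H_pert ∧ K
(`halvingBasinP_of_perturbative_core`).  UNDECIDED · TRUE-type · ATTACKABLE-XL as a whole only through its two halves: the compactness proof meets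
CONCENTRATION (cores) — see K.  INSTRUMENT: census TAG 163 add-on H-LEVEL/M (a): the contraction factor must become LEVEL-INDEPENDENT as `η ↓ 0`
(the existential basin is exactly what (a) measures).  Why it might fail: cores (K false) — then H♭ is false at every large R while A∞ may survive.
[this file, g26] -/
def HalvingBasinP (aHi Λ θ : ℝ) : Prop :=
  LatticeLiouvilleCert → LayeredLiouvilleCert → ∀ δ : ℝ, 0 < δ → ∃ κ₀ : ℝ, 0 < κ₀ ∧ ∃ M : ℝ, 1 ≤ M ∧ ∃ R₀ : ℝ, 0 < R₀ ∧
    ∀ S : Set E3, IsDoorSetP aHi δ S → (∀ q ∈ S, IsTwoShellAffineGood θ S q) →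
      ∀ η : ℝ, 0 < η → η ≤ κ₀ → ∀ R : ℝ, R₀ ≤ R →
        NearHomL2BD Λ η 4 S (atomsIn (μS S) 0 (M * R)) → NearHomL2BD Λ (η / 2) 4 S (atomsIn (μS S) 0 R)

/-- **H_pert(aHi; Λ, θ) «PerturbativeDecay»** — the SPECIAL (sup-flat) class of the second cut: given both certificates, for every δ and every target
contraction `c > 0` there are a sup ceiling `τ₀ > 0`, a level ceiling `κ₀ > 0`, a ratio `M ≥ 1` and a floor `R₀ > 0` such that on every θ-good
`aHi`-door set, at every level `0 < η ≤ κ₀` and radius `R ≥ R₀`: the window of radius `M·R` `η`-flat in mean square AND `τ₀`-flat in sup under ONE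
chart (`NearHomL2SupBD Λ η τ₀ 4`) ⇒ the window of radius `R` is `c·η`-flat in mean square.  THE HONEST PERTURBATIVE STATEMENT: sup-flatness makes the
linearisation at the chart uniformly valid (strain uniformly `O(τ₀)`-close to the chart on the whole window), blow-up limits converge strongly (discrete
Caccioppoli for the linearised layered operator: no concentration), the limit is `layeredKernel`- or `ljKernel`-harmonic of bounded gradient, affine with
free layer constants by the certificates = tangent to the chart family, and the Campanato quotient estimate gives `C/M²` — any `c` by the choice of `M`.
WEAKER than H(κ) for every `κ > 0` (`perturbativeDecayP_of_flatnessHalvingP`: iterate H along `M^j`, ignore the sup clause).  UNDECIDED · TRUE-type ·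
ATTACKABLE·L–XL (discrete interior regularity for an infinite-range linearised lattice system + the nonlinear remainder).  Why it might fail: the discrete
floor (interior estimates for the infinite-range linearised operator at bounded R — absorbed by `R₀` only if the compactness step is uniform), or a
reference defect of `LayeredHom` charts (free per-layer offsets need not be an equilibrium: source term `O(√η)` unless re-centred — g25 caveat (b)).
[this file, g26] -/
def PerturbativeDecayP (aHi Λ θ : ℝ) : Prop :=
  LatticeLiouvilleCert → LayeredLiouvilleCert → ∀ δ : ℝ, 0 < δ → ∀ c : ℝ, 0 < c →
    ∃ τ₀ : ℝ, 0 < τ₀ ∧ ∃ κ₀ : ℝ, 0 < κ₀ ∧ ∃ M : ℝ, 1 ≤ M ∧ ∃ R₀ : ℝ, 0 < R₀ ∧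
      ∀ S : Set E3, IsDoorSetP aHi δ S → (∀ q ∈ S, IsTwoShellAffineGood θ S q) →
        ∀ η : ℝ, 0 < η → η ≤ κ₀ → ∀ R : ℝ, R₀ ≤ R →
          NearHomL2SupBD Λ η τ₀ 4 S (atomsIn (μS S) 0 (M * R)) → NearHomL2BD Λ (c * η) 4 S (atomsIn (μS S) 0 R)

/-- **K(aHi; Λ, θ) «CoreExclusion»** — the GENERIC (cored) class of the second cut is EMPTY: given both certificates, for every δ there are constants
`C ≥ 1`, `M ≥ 1` such that for every sup target `τ₀ > 0` there are a level ceiling `κ₁ > 0` and a floor `R₀ > 0` with: on every θ-good `aHi`-door set,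
at every level `0 < η ≤ κ₁` and radius `R ≥ R₀`, `η`-flatness in mean square of the window of radius `M·R` ⇒ a chart of the window of radius `R` that is
`C·η`-flat in mean square AND `τ₀`-flat in sup.  = the interior `L² → L^∞` estimate for the NONLINEAR equilibrium problem = NO CORES: a localised
finite-amplitude distortion has sup-misfit `O(1)` at arbitrarily small window mean square.  (`C` pays for re-fitting the chart on the sub-window:
count ratio of the two windows, tree `WindowCounting`.)  UNDECIDED · TRUE-type (exactly layered door sets: misfit 0 in both senses) · IDEA-NEEDED
(the finite-amplitude content of v9's H, ISOLATED; candidate ideas: analyticity / unique continuation from infinity of the LJ far field of a compactly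
supported distortion — all multipole moments of `∑_q (δ_q − δ_{q₀})` vanish; energy–virial identities of Pohozaev type for lattice equilibria) ·
INSTRUMENTABLE: CORE-HUNT.  Incomparable with H as typed; with H_pert it gives H♭ (`halvingBasinP_of_perturbative_core`). [this file, g26] -/
def CoreExclusionP (aHi Λ θ : ℝ) : Prop :=
  LatticeLiouvilleCert → LayeredLiouvilleCert → ∀ δ : ℝ, 0 < δ → ∃ C : ℝ, 1 ≤ C ∧ ∃ M : ℝ, 1 ≤ M ∧ ∀ τ₀ : ℝ, 0 < τ₀ →
    ∃ κ₁ : ℝ, 0 < κ₁ ∧ ∃ R₀ : ℝ, 0 < R₀ ∧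
      ∀ S : Set E3, IsDoorSetP aHi δ S → (∀ q ∈ S, IsTwoShellAffineGood θ S q) →
        ∀ η : ℝ, 0 < η → η ≤ κ₁ → ∀ R : ℝ, R₀ ≤ R →
          NearHomL2BD Λ η 4 S (atomsIn (μS S) 0 (M * R)) → NearHomL2SupBD Λ (C * η) τ₀ 4 S (atomsIn (μS S) 0 R)

/-- A∞ at `aHi = 1` (the v9 door binder `IsDoorSet`). [this file, g26] -/
def ScaleExtinction (Λ θ κ : ℝ) : Prop :=
  LatticeLiouvilleCert → LayeredLiouvilleCert → ∀ δ : ℝ, 0 < δ → ∀ S : Set E3, IsDoorSet δ S → (∀ q ∈ S, IsTwoShellAffineGood θ S q) →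
    (∀ R : ℝ, 0 < R → NearHomL2BD Λ κ 4 S (atomsIn (μS S) 0 R)) → EventuallyLayerFlat Λ S

/-- U at `aHi = 1`. [this file, g26] -/
def FlatnessUpgrade (Λ θ κ : ℝ) : Prop :=
  LatticeLiouvilleCert → LayeredLiouvilleCert → ∀ δ : ℝ, 0 < δ → ∀ S : Set E3, IsDoorSet δ S → (∀ q ∈ S, IsTwoShellAffineGood θ S q) →
    (∀ R : ℝ, 0 < R → NearHomL2BD Λ κ 4 S (atomsIn (μS S) 0 R)) → EventuallyLayerFlat Λ S → AsymptoticallyLayerFlat Λ S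

/-- H♭ at `aHi = 1`. [this file, g26] -/
def HalvingBasin (Λ θ : ℝ) : Prop :=
  LatticeLiouvilleCert → LayeredLiouvilleCert → ∀ δ : ℝ, 0 < δ → ∃ κ₀ : ℝ, 0 < κ₀ ∧ ∃ M : ℝ, 1 ≤ M ∧ ∃ R₀ : ℝ, 0 < R₀ ∧
    ∀ S : Set E3, IsDoorSet δ S → (∀ q ∈ S, IsTwoShellAffineGood θ S q) →
      ∀ η : ℝ, 0 < η → η ≤ κ₀ → ∀ R : ℝ, R₀ ≤ R →
        NearHomL2BD Λ η 4 S (atomsIn (μS S) 0 (M * R)) → NearHomL2BD Λ (η / 2) 4 S (atomsIn (μS S) 0 R)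

/-- H_pert at `aHi = 1`. [this file, g26] -/
def PerturbativeDecay (Λ θ : ℝ) : Prop :=
  LatticeLiouvilleCert → LayeredLiouvilleCert → ∀ δ : ℝ, 0 < δ → ∀ c : ℝ, 0 < c →
    ∃ τ₀ : ℝ, 0 < τ₀ ∧ ∃ κ₀ : ℝ, 0 < κ₀ ∧ ∃ M : ℝ, 1 ≤ M ∧ ∃ R₀ : ℝ, 0 < R₀ ∧
      ∀ S : Set E3, IsDoorSet δ S → (∀ q ∈ S, IsTwoShellAffineGood θ S q) →
        ∀ η : ℝ, 0 < η → η ≤ κ₀ → ∀ R : ℝ, R₀ ≤ R →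
          NearHomL2SupBD Λ η τ₀ 4 S (atomsIn (μS S) 0 (M * R)) → NearHomL2BD Λ (c * η) 4 S (atomsIn (μS S) 0 R)

/-- K at `aHi = 1`. [this file, g26] -/
def CoreExclusion (Λ θ : ℝ) : Prop :=
  LatticeLiouvilleCert → LayeredLiouvilleCert → ∀ δ : ℝ, 0 < δ → ∃ C : ℝ, 1 ≤ C ∧ ∃ M : ℝ, 1 ≤ M ∧ ∀ τ₀ : ℝ, 0 < τ₀ →
    ∃ κ₁ : ℝ, 0 < κ₁ ∧ ∃ R₀ : ℝ, 0 < R₀ ∧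
      ∀ S : Set E3, IsDoorSet δ S → (∀ q ∈ S, IsTwoShellAffineGood θ S q) →
        ∀ η : ℝ, 0 < η → η ≤ κ₁ → ∀ R : ℝ, R₀ ≤ R →
          NearHomL2BD Λ η 4 S (atomsIn (μS S) 0 (M * R)) → NearHomL2SupBD Λ (C * η) τ₀ 4 S (atomsIn (μS S) 0 R)

/-- at `aHi = 1`, E_P IS part G's E. -/
theorem flatnessExtinctionP_one_iff (Λ θ κ : ℝ) : FlatnessExtinctionP 1 Λ θ κ ↔ FlatnessExtinction Λ θ κ := Iff.rfl

/-- at `aHi = 1`, A∞_P IS A∞. -/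
theorem scaleExtinctionP_one_iff (Λ θ κ : ℝ) : ScaleExtinctionP 1 Λ θ κ ↔ ScaleExtinction Λ θ κ := Iff.rfl

/-- at `aHi = 1`, U_P IS U. -/
theorem flatnessUpgradeP_one_iff (Λ θ κ : ℝ) : FlatnessUpgradeP 1 Λ θ κ ↔ FlatnessUpgrade Λ θ κ := Iff.rfl

/-- at `aHi = 1`, H♭_P IS H♭. -/
theorem halvingBasinP_one_iff (Λ θ : ℝ) : HalvingBasinP 1 Λ θ ↔ HalvingBasin Λ θ := Iff.rfl

/-- at `aHi = 1`, H_pert,P IS H_pert. -/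
theorem perturbativeDecayP_one_iff (Λ θ : ℝ) : PerturbativeDecayP 1 Λ θ ↔ PerturbativeDecay Λ θ := Iff.rfl

/-- at `aHi = 1`, K_P IS K. -/
theorem coreExclusionP_one_iff (Λ θ : ℝ) : CoreExclusionP 1 Λ θ ↔ CoreExclusion Λ θ := Iff.rfl

/-! ## §F.3  The first cut E ⟺ A∞ ∧ U (hypothesis-splitting; PROVED both ways) and U ⟸ H♭ ⟸ H (PROVED) -/

/-- **E ⟸ A∞ ∧ U** (modus ponens at the threshold «eventually flat»). -/
theorem flatnessExtinctionP_of_scale_upgrade {aHi Λ θ κ : ℝ} (hA : ScaleExtinctionP aHi Λ θ κ) (hU : FlatnessUpgradeP aHi Λ θ κ) :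
    FlatnessExtinctionP aHi Λ θ κ :=
  fun hP hL δ hδ S hS hO hflat => hU hP hL δ hδ S hS hO hflat (hA hP hL δ hδ S hS hO hflat)

/-- **A∞ ⟸ E** (weaken the conclusion): A∞ is WEAKER than E. -/
theorem scaleExtinctionP_of_extinction {aHi Λ θ κ : ℝ} (hE : FlatnessExtinctionP aHi Λ θ κ) : ScaleExtinctionP aHi Λ θ κ :=
  fun hP hL δ hδ S hS hO hflat => (hE hP hL δ hδ S hS hO hflat).eventually

/-- **U ⟸ E** (ignore the extra hypothesis): U is WEAKER than E. -/
theorem flatnessUpgradeP_of_extinction {aHi Λ θ κ : ℝ} (hE : FlatnessExtinctionP aHi Λ θ κ) : FlatnessUpgradeP aHi Λ θ κ :=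
  fun hP hL δ hδ S hS hO hflat _ => hE hP hL δ hδ S hS hO hflat

/-- ★ **THE FIRST CUT IS EXACT: E ⟺ A∞ ∧ U.** -/
theorem flatnessExtinctionP_iff_scale_upgrade (aHi Λ θ κ : ℝ) :
    FlatnessExtinctionP aHi Λ θ κ ↔ ScaleExtinctionP aHi Λ θ κ ∧ FlatnessUpgradeP aHi Λ θ κ :=
  ⟨fun h => ⟨scaleExtinctionP_of_extinction h, flatnessUpgradeP_of_extinction h⟩, fun h => flatnessExtinctionP_of_scale_upgrade h.1 h.2⟩

/-- ★ **U ⟸ H♭ at EVERY κ** (PROVED; the κ-flatness hypothesis of U is not even used): eventual κ₀-flatness supplies κ₀-flat windows of every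
radius `≥ R₁`, and part G's dyadic iteration runs from the floor `max R₀ R₁`: misfit `≤ κ₀/2^k` on every root window of radius `≥ max R₀ R₁`
for every `k`, then Archimedes. -/
theorem flatnessUpgradeP_of_halvingBasin {aHi Λ θ : ℝ} (κ : ℝ) (hH : HalvingBasinP aHi Λ θ) : FlatnessUpgradeP aHi Λ θ κ := by
  intro hP hL δ hδ S hS hO _hflat hev
  obtain ⟨κ₀, hκ₀, M, hM, R₀, hR₀, hstep⟩ := hH hP hL δ hδ
  obtain ⟨R₁, hR₁⟩ := hev κ₀ hκ₀
  have iter : ∀ k : ℕ, ∀ R : ℝ, max R₀ R₁ ≤ R → NearHomL2BD Λ (κ₀ / 2 ^ k) 4 S (atomsIn (μS S) 0 R) := by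
    intro k
    induction k with
    | zero => intro R hR; simpa using hR₁ R ((le_max_right _ _).trans hR)
    | succ k ih =>
      intro R hR
      have hRnn : 0 ≤ R := hR₀.le.trans ((le_max_left _ _).trans hR)
      have hMR : max R₀ R₁ ≤ M * R := hR.trans (le_mul_of_one_le_left hRnn hM)
      have h1 := hstep S hS hO (κ₀ / 2 ^ k) (by positivity) (div_le_self hκ₀.le (one_le_pow₀ (by norm_num))) R
        ((le_max_left _ _).trans hR) (ih (M * R) hMR)
      rwa [pow_succ, ← div_div]
  refine ⟨max R₀ R₁, fun ε hε R hR => ?_⟩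
  obtain ⟨k, hk⟩ := exists_pow_lt_of_lt_one (div_pos hε hκ₀) (by norm_num : (1 / 2 : ℝ) < 1)
  refine nearHomL2BD_mono ?_ (iter k R hR)
  rw [div_eq_mul_inv, ← inv_pow, show ((2:ℝ)⁻¹) = 1 / 2 by norm_num]
  have := (lt_div_iff₀ hκ₀).1 hk
  linarith [this]

/-- **H♭ ⟸ H(κ)** for every `κ > 0` (take `κ₀ := κ`): H♭ is WEAKER than v9's H at every literal. -/
theorem halvingBasinP_of_flatnessHalvingP {aHi Λ θ κ : ℝ} (hκ : 0 < κ) (hH : FlatnessHalvingP aHi Λ θ κ) : HalvingBasinP aHi Λ θ :=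
  fun hP hL δ hδ => ⟨κ, hκ, hH hP hL δ hδ⟩

/-- ★ **E ⟸ A∞ ∧ H♭** at every κ. -/
theorem flatnessExtinctionP_of_scale_basin {aHi Λ θ κ : ℝ} (hA : ScaleExtinctionP aHi Λ θ κ) (hH : HalvingBasinP aHi Λ θ) :
    FlatnessExtinctionP aHi Λ θ κ :=
  flatnessExtinctionP_of_scale_upgrade hA (flatnessUpgradeP_of_halvingBasin κ hH)

/-- **E_P ⟹ P♭_P** at every `Λ ≤ 4` (Z = part G's `exactEndgame_of_le`; `IsDoorSetP` door sets are rooted `hS.1` and separated `hS.2.1`). -/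
theorem linearisedFlatnessLayeredP_of_extinctionP {aHi Λ θ κ : ℝ} (hΛ : Λ ≤ 4) (hE : FlatnessExtinctionP aHi Λ θ κ) :
    LinearisedFlatnessLayeredP aHi Λ θ κ :=
  fun hP hL δ hδ S hS hO hflat => exactEndgame_of_le hΛ δ hδ S hS.1 hS.2.1 (hE hP hL δ hδ S hS hO hflat)

/-- ★★ **P♭_P ⟸ A∞_P ∧ H♭_P** (`Λ ≤ 4`, every ceiling, every κ). -/
theorem linearisedFlatnessLayeredP_of_scale_basin {aHi Λ θ κ : ℝ} (hΛ : Λ ≤ 4) (hA : ScaleExtinctionP aHi Λ θ κ) (hH : HalvingBasinP aHi Λ θ) :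
    LinearisedFlatnessLayeredP aHi Λ θ κ :=
  linearisedFlatnessLayeredP_of_extinctionP hΛ (flatnessExtinctionP_of_scale_basin hA hH)

end Summit.AtomisticToContinuum.Crystallization.Theorems.ChartedZeroExcessLayeredLatticeLiouville

end
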